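import Summits.ResolutionOfSingularities.ResolutionOfSingularities.Theorems.FrobeniusClosingPatchingRelPerfectDepthHSepComponents
import Literature.AlgebraicGeometry.Resolution.BlowupDisjointCentreWeights
import Literature.AlgebraicGeometry.Resolution.HasSNCWithOffCentre
import Literature.AlgebraicGeometry.Resolution.OrderSemicontinuity
import Literature.AlgebraicGeometry.Resolution.AlterationsNormalFormBlowupParts
import Literature.AlgebraicGeometry.Resolution.ExceptionalDivisorIrreducible
import Literature.AlgebraicGeometry.Resolution.CartierDivisorControlledTransform
import HarnessLib

/-!
# Crux `PatchingRelPerfect` (stmt-ResolutionOfSingularities-16161), chain W5.2 — F7(β) (β-AX) X2b, E-SIDE: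
# the LAW-PARAMETRIC piece step of the multi-host CJS transport

[OURS · L1 W5.2 · F7(β) X2b E-side (res-L1-w52-plan-1 NAMING G11-8 (3) / spec v4 `F7BETA-ASSEMBLY-SPEC.md` T2a–T2b; hand
res-D-pv-054)] Fact-free; def-free; NOT statements of the manuscript under review (Hironaka 2017); AI-written, weaker than expert
review.

The E-side state of the multi-host transport on the carrier `E` (the CJS stage up to an isomorphism `e : E ≅ Z_k`) is: host TRACES
`tr : Fin n → E.IdealSheafData` (effective Cartier, covering `e⁻¹ X_k`) and boundary traces `𝓑 : List E.IdealSheafData` (simple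
normal crossings, drawn on `e⁻¹ B_k` and covering it).  Compared with the single-host, weight-ONE transport of R5ᴴ N3
(`HSepCJS.piece_single`), the host law is PARAMETRIC: a piece `Z` of a CJS centre is blown up with exponents `m i` supplied by
the caller (`tr i ≤ 𝓘(Z) ^ m i`, the X-side's `CylState.lift` hypothesis), the hosts becoming `τᶜ(tr i, m i)`
(`τ^* tr i = 𝓘(exc)^{m i} · τᶜ(tr i, m i)`), the boundary traces their strict transforms plus the exceptional divisor.
* `piece_step` — ONE piece: the new state (regular, hosts effective Cartier with the factorisation, boundary snc), the bounds
  `τ⁻¹(Supp tr i ∖ Z) ⊆ Supp τᶜ(tr i, m i) ⊆ τ⁻¹ Supp tr i`, the boundary bound and cover — for ANY blowing up `τ` along `𝓘(Z)`.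
* `centre_transport` — the data of a DISJOINT piece (irreducible, regular, inside a host, snc with the boundary, the exponent
  hypothesis for its own exponents) survive the blowing up of the first piece.
* `centre_pieces` — a CJS centre `C ⊆ X_k` on `Z_k` (regular, n.c. with `B_k`), read on `E` through `e`, splits into pieces each
  carrying the piece data (the exponent hypothesis excepted: it is the X-side's equimultiplicity input).

## References
* V. Cossart, U. Jannsen, S. Saito, LNM 2270 (2020), Thm. 1.4, (6.2), Def. 4.1. [CossartJannsenSaito2020]
* J. Kollár, *Lectures on Resolution of Singularities* (2007), Def. 3.25, 3.30.2. [Kollar2007]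
* E. Bierstone, D. Grigoriev, P. Milman, J. Włodarczyk (2011), Def. 3.1.3, §3.2, §4 Step 2b. [BierstoneGrigorievMilmanWlodarczyk2011]
-/

-- `Summit.<Summit>.<Sub>.Theorems` with `Sub = Summit` (single-conjunct summit, D-0017)
set_option linter.dupNamespace false

noncomputable section

open CategoryTheory CategoryTheory.Limits AlgebraicGeometry TopologicalSpace IsLocalRing
open Literature.AlgebraicGeometry.Resolution Scheme.IdealSheafData

namespace Summit.ResolutionOfSingularities.ResolutionOfSingularities.Theorems

universe u

namespace MultiHostCJS

open WeightTwoB Literature.AlgebraicGeometry.Hironaka2017.S16Proof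

/-! ## §1 An irreducible set inside finitely many host supports lies inside one of them -/

/-- An irreducible subset of a finite union of closed sets lies in one of them (host form). [folklore] -/
theorem exists_subset_support_of_subset_iUnion {E : Scheme.{u}} {n : ℕ} (tr : Fin n → E.IdealSheafData) {Z : Set E}
    (hirr : IsIrreducible Z) (hZ : Z ⊆ ⋃ i, ((tr i).support : Set E)) : ∃ i, Z ⊆ ((tr i).support : Set E) := by
  classical
  obtain ⟨z, hz, hZz⟩ := (isIrreducible_iff_sUnion_isClosed.mp hirr)
    (Finset.univ.image fun i => ((tr i).support : Set E))
    (fun z hz => by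
      obtain ⟨i, -, rfl⟩ := Finset.mem_image.mp hz
      exact (tr i).support.isClosed)
    (fun x hx => by
      obtain ⟨i, hi⟩ := Set.mem_iUnion.mp (hZ hx)
      exact Set.mem_sUnion.mpr ⟨_, Finset.mem_coe.mpr (Finset.mem_image.mpr ⟨i, Finset.mem_univ _, rfl⟩), hi⟩)
  obtain ⟨i, -, rfl⟩ := Finset.mem_image.mp hz
  exact ⟨i, hZz⟩

/-! ## §2 The law-parametric piece step -/

section Step

variable {E : Scheme.{u}} [IsLocallyNoetherian E] {n : ℕ} {tr : Fin n → E.IdealSheafData} {𝓑 : List E.IdealSheafData}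
  {Z : Closeds E} {E' : Scheme.{u}} {τ : E' ⟶ E}

omit [IsLocallyNoetherian E] in
/-- **Lower bound**: `τ⁻¹(Supp H ∖ Z) ⊆ Supp τᶜ(H, m)` for every exponent (off the exceptional divisor the controlled transform is
the total transform). [cite: BierstoneGrigorievMilmanWlodarczyk2011, §3.2] -/
theorem preimage_diff_subset_support_controlledTransform (hτ : IsBlowup τ (vanishingIdeal Z)) (H : E.IdealSheafData)
    (m : ℕ) :
    τ ⁻¹' ((H.support : Set E) \ (Z : Set E)) ⊆ ((controlledTransform τ (vanishingIdeal Z) H m).support : Set E') := by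
  intro x' hx'
  refine hτ.closure_preimage_diff_subset_support_controlledTransform m (subset_closure ?_)
  rw [Scheme.IdealSheafData.coe_support_vanishingIdeal]
  exact hx'

omit [IsLocallyNoetherian E] in
/-- **Upper bound**: `Supp τᶜ(H, m) ⊆ τ⁻¹(Supp H)`. [folklore] -/
theorem support_controlledTransform_subset (C H : E.IdealSheafData) (m : ℕ) :
    ((controlledTransform τ C H m).support : Set E') ⊆ τ ⁻¹' (H.support : Set E) := by
  intro x' hx'
  have h : x' ∈ ((H.comap τ).support : Set E') := support_antitone (comap_le_controlledTransform τ C H m) hx'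
  exact (mem_support_comap_iff τ H x').mp h

omit [IsLocallyNoetherian E] in
/-- **The boundary bound**: every new boundary trace lies over `B₀ ⊇ ⋃ Supp 𝓑 ∪ Z`. [cite: CossartJannsenSaito2020, (6.2)] -/
theorem bd_bound {B₀ : Set E} (h𝓑B : ∀ T ∈ 𝓑, (T.support : Set E) ⊆ B₀) (hZB : (Z : Set E) ⊆ B₀) :
    ∀ T' ∈ 𝓑.map (strictTransformIdeal τ (vanishingIdeal Z)) ++ [(vanishingIdeal Z).comap τ],
      (T'.support : Set E') ⊆ τ ⁻¹' B₀ := by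
  intro T' hT'
  rcases List.mem_append.mp hT' with h | h
  · obtain ⟨T, hT, rfl⟩ := List.mem_map.mp h
    intro x' hx'
    exact h𝓑B T hT (mem_support_of_mem_support_strictTransformIdeal hx')
  · rw [List.mem_singleton] at h
    subst h
    intro x' hx'
    rw [Scheme.IdealSheafData.support_comap, Closeds.coe_preimage, Scheme.IdealSheafData.coe_support_vanishingIdeal] at hx'
    exact hZB hx'

/-- **The boundary cover**: a point over `⋃ Supp 𝓑 ∪ Z` lies on a new boundary trace. [cite: CossartJannsenSaito2020, (6.2)] -/
theorem bd_cover (hτ : IsBlowup τ (vanishingIdeal Z)) {x' : E'}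
    (hx : (∃ T ∈ 𝓑, τ x' ∈ T.support) ∨ τ x' ∈ (Z : Set E)) :
    ∃ T' ∈ 𝓑.map (strictTransformIdeal τ (vanishingIdeal Z)) ++ [(vanishingIdeal Z).comap τ], x' ∈ T'.support := by
  haveI : IsLocallyNoetherian E' := hτ.isLocallyNoetherian
  by_cases hx'E : x' ∈ ((vanishingIdeal Z).comap τ).support
  · exact ⟨_, List.mem_append_right _ (List.mem_singleton_self _), hx'E⟩
  · have hxZ : τ x' ∉ (Z : Set E) := fun h => hx'E <| (mem_support_comap_iff τ (vanishingIdeal Z) x').mpr <| by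
      rw [Scheme.IdealSheafData.coe_support_vanishingIdeal]; exact h
    rcases hx with ⟨T, hT, hxT⟩ | h
    · refine ⟨strictTransformIdeal τ (vanishingIdeal Z) T, List.mem_append_left _ (List.mem_map.mpr ⟨T, hT, rfl⟩), ?_⟩
      exact (mem_support_strictTransformIdeal_iff_of_not_mem_exceptional τ (vanishingIdeal Z) T hx'E).mpr hxT
    · exact absurd h hxZ

/-! ### Irreducibility of the new boundary traces -/

/-- **The support of the strict transform of an effective Cartier divisor** under the blowing up of a regular irreducible piece
`Z` lying on some effective Cartier divisor (so nowhere dense): `Supp st(T) = cl τ⁻¹(Supp T ∖ Z)` — the strict transform is the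
controlled transform with the generic order (res-D-pv-026's (L-A)), whose support has no exceptional component (Kollár 3.30.2).
[cite: Kollar2007, 3.30.2] -/
theorem support_strictTransformIdeal_eq_closure [IsIntegral E] (hE : Scheme.IsRegular E) (hirr : IsIrreducible (Z : Set E))
    (hZ : Scheme.IsRegular (vanishingIdeal Z).subscheme) {H : E.IdealSheafData} (hH : IsEffectiveCartier H)
    (hZH : (Z : Set E) ⊆ H.support) {T : E.IdealSheafData} (hT : IsEffectiveCartier T)
    (hτ : IsBlowup τ (vanishingIdeal Z)) :
    ((strictTransformIdeal τ (vanishingIdeal Z) T).support : Set E') = closure (τ ⁻¹' ((T.support : Set E) \ (Z : Set E))) := by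
  obtain ⟨η, hη⟩ : ∃ η : E, IsGenericPoint η (Z : Set E) := QuasiSober.sober hirr Z.isClosed
  have hZsupp : (((vanishingIdeal Z).support : Closeds E) : Set E) = Z := Scheme.IdealSheafData.coe_support_vanishingIdeal Z
  have hη' : IsGenericPoint η (((vanishingIdeal Z).support : Closeds E) : Set E) := by rwa [hZsupp]
  have hint : interior (((vanishingIdeal Z).support : Closeds E) : Set E) = ∅ :=
    interior_eq_empty_of_isGenericPoint_of_mem_support hη' hH (hZH hη.mem)
  have hTne : T ≠ ⊥ := HSepCJS.ne_bot_of_isEffectiveCartier hT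
  obtain ⟨m, hm⟩ : ∃ m : ℕ, idealOrder T η = m := ENat.ne_top_iff_exists.mp (idealOrder_ne_top hTne η) |>.imp fun _ h => h.symm
  rw [hτ.strictTransformIdeal_eq_controlledTransform hE hZ hη' hint hm hT,
    hτ.support_controlledTransform_eq_closure hE hZ hη' hint hm hT, hZsupp]

/-- **The strict transform of a boundary trace with (pre)irreducible support has (pre)irreducible support**: it is the closure of
`τ⁻¹(Supp T ∖ Z)`, homeomorphic to the relatively open `Supp T ∖ Z` (`τ` is an isomorphism off the centre). [folklore] -/
theorem isPreirreducible_support_strictTransformIdeal [IsIntegral E] (hE : Scheme.IsRegular E)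
    (hirr : IsIrreducible (Z : Set E)) (hZ : Scheme.IsRegular (vanishingIdeal Z).subscheme) {H : E.IdealSheafData}
    (hH : IsEffectiveCartier H) (hZH : (Z : Set E) ⊆ H.support) {T : E.IdealSheafData} (hT : IsEffectiveCartier T)
    (hTirr : IsPreirreducible (T.support : Set E)) (hτ : IsBlowup τ (vanishingIdeal Z)) :
    IsPreirreducible ((strictTransformIdeal τ (vanishingIdeal Z) T).support : Set E') := by
  rw [support_strictTransformIdeal_eq_closure hE hirr hZ hH hZH hT hτ]
  refine IsPreirreducible.closure ?_
  -- `τ` is an isomorphism over the complement `U` of the centre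
  haveI : IsIso (τ ∣_ ⟨(((vanishingIdeal Z).support : Closeds E) : Set E)ᶜ, (vanishingIdeal Z).support.isClosed.isOpen_compl⟩) :=
    hτ.isIso_compl
  have hU : (T.support : Set E) \ (Z : Set E) ⊆
      ((⟨(((vanishingIdeal Z).support : Closeds E) : Set E)ᶜ, (vanishingIdeal Z).support.isClosed.isOpen_compl⟩ : E.Opens) : Set E) := by
    intro x hx
    change x ∈ (((vanishingIdeal Z).support : Closeds E) : Set E)ᶜ
    rw [Scheme.IdealSheafData.coe_support_vanishingIdeal]
    exact hx.2
  rcases (τ ⁻¹' ((T.support : Set E) \ (Z : Set E))).eq_empty_or_nonempty with h0 | hne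
  · rw [h0]; exact isPreirreducible_empty
  · have hne' : ((T.support : Set E) \ (Z : Set E)).Nonempty := by
      obtain ⟨x', hx'⟩ := hne
      exact ⟨τ x', hx'⟩
    have hirrA : IsIrreducible ((T.support : Set E) \ (Z : Set E)) :=
      ⟨hne', isPreirreducible_inter_of_isOpen hTirr Z.isClosed.isOpen_compl⟩
    exact (isIrreducible_preimage_of_isIso_morphismRestrict τ _ hirrA hU).isPreirreducible

/-- **The exceptional divisor of a regular irreducible nowhere-dense piece is irreducible** (it is a projective bundle over the
piece; res-type-067's `IsBlowup.isIrreducible_preimage_of_isRegular`). [cite: Liu2002, Thm. 8.1.19 (b)] -/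
theorem isIrreducible_support_exceptional (hE : Scheme.IsRegular E) (hirr : IsIrreducible (Z : Set E))
    (hZ : Scheme.IsRegular (vanishingIdeal Z).subscheme) {H : E.IdealSheafData} (hH : IsEffectiveCartier H)
    (hZH : (Z : Set E) ⊆ H.support) (hτ : IsBlowup τ (vanishingIdeal Z)) :
    IsIrreducible ((((vanishingIdeal Z).comap τ).support : Closeds E') : Set E') := by
  obtain ⟨η, hη⟩ : ∃ η : E, IsGenericPoint η (Z : Set E) := QuasiSober.sober hirr Z.isClosed
  have hint : interior (Z : Set E) = ∅ := interior_eq_empty_of_isGenericPoint_of_mem_support hη hH (hZH hη.mem)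
  rw [Scheme.IdealSheafData.support_comap, Closeds.coe_preimage, Scheme.IdealSheafData.coe_support_vanishingIdeal]
  exact hτ.isIrreducible_preimage_of_isRegular hE hZ hirr hint

/-- The new boundary traces have preirreducible supports if the old ones have. [folklore] -/
theorem bd_isPreirreducible [IsIntegral E] (hE : Scheme.IsRegular E) (hirr : IsIrreducible (Z : Set E))
    (hZ : Scheme.IsRegular (vanishingIdeal Z).subscheme) {H : E.IdealSheafData} (hH : IsEffectiveCartier H)
    (hZH : (Z : Set E) ⊆ H.support) (h𝓑c : ∀ T ∈ 𝓑, IsEffectiveCartier T)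
    (h𝓑irr : ∀ T ∈ 𝓑, IsPreirreducible (T.support : Set E)) (hτ : IsBlowup τ (vanishingIdeal Z)) :
    ∀ T' ∈ 𝓑.map (strictTransformIdeal τ (vanishingIdeal Z)) ++ [(vanishingIdeal Z).comap τ],
      IsPreirreducible (T'.support : Set E') := by
  intro T' hT'
  rcases List.mem_append.mp hT' with h | h
  · obtain ⟨T, hT, rfl⟩ := List.mem_map.mp h
    exact isPreirreducible_support_strictTransformIdeal hE hirr hZ hH hZH (h𝓑c T hT) (h𝓑irr T hT) hτ
  · rw [List.mem_singleton] at h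
    subst h
    exact (isIrreducible_support_exceptional hE hirr hZ hH hZH hτ).isPreirreducible

/-- **The data of a DISJOINT piece survive the blow-up of the first piece** (on `τ⁻¹Z₂`): irreducible, regular, inside the
transported host that contained it, snc with the new boundary traces, and the exponent hypothesis for its own exponents `m₂`
(`τᶜ(tr i, m i) ≤ 𝓘(τ⁻¹Z₂) ^ m₂ i`, res-type-041's `IsBlowup.controlledTransform_le_pow_comap_of_disjoint`).
[cite: Kollar2007, Def. 3.25] [cite: BierstoneGrigorievMilmanWlodarczyk2011, §3.2, §4 Step 2b] -/
theorem centre_transport (hsnc : HasSNCWith 𝓑 (vanishingIdeal Z)) (hτ : IsBlowup τ (vanishingIdeal Z)) (m : Fin n → ℕ)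
    {Z₂ : Closeds E} (hirr₂ : IsIrreducible (Z₂ : Set E)) (hZ₂ : Scheme.IsRegular (vanishingIdeal Z₂).subscheme)
    {i : Fin n} (hZ₂i : (Z₂ : Set E) ⊆ (tr i).support) (hsnc₂ : HasSNCWith 𝓑 (vanishingIdeal Z₂))
    (m₂ : Fin n → ℕ) (hm₂ : ∀ j, tr j ≤ vanishingIdeal Z₂ ^ m₂ j) (hd : Disjoint (Z : Set E) Z₂) :
    IsIrreducible ((Z₂.preimage τ.continuous : Closeds E') : Set E') ∧
      Scheme.IsRegular (vanishingIdeal (Z₂.preimage τ.continuous : Closeds E')).subscheme ∧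
      ((Z₂.preimage τ.continuous : Closeds E') : Set E') ⊆ (controlledTransform τ (vanishingIdeal Z) (tr i) (m i)).support ∧
      HasSNCWith (𝓑.map (strictTransformIdeal τ (vanishingIdeal Z)) ++ [(vanishingIdeal Z).comap τ])
        (vanishingIdeal (Z₂.preimage τ.continuous)) ∧
      (∀ j, controlledTransform τ (vanishingIdeal Z) (tr j) (m j) ≤ vanishingIdeal (Z₂.preimage τ.continuous) ^ m₂ j) := by
  haveI : IsLocallyNoetherian E' := hτ.isLocallyNoetherian
  have hd' : Disjoint (Z₂ : Set E) ((vanishingIdeal Z).support : Set E) := by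
    rw [Scheme.IdealSheafData.coe_support_vanishingIdeal]; exact hd.symm
  have hdC : Disjoint ((vanishingIdeal Z).support : Set E) ((vanishingIdeal Z₂).support : Set E) := by
    rw [Scheme.IdealSheafData.coe_support_vanishingIdeal, Scheme.IdealSheafData.coe_support_vanishingIdeal]; exact hd
  have hcomap : (vanishingIdeal Z₂).comap τ = vanishingIdeal (Z₂.preimage τ.continuous) :=
    hτ.comap_vanishingIdeal_of_disjoint Z₂ hd'
  refine ⟨hτ.isIrreducible_preimage_of_disjoint Z₂ hd' hirr₂, hτ.isRegular_subscheme_vanishingIdeal_preimage Z₂ hd' hZ₂,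
    fun y' hy' => ?_, ?_, fun j => ?_⟩
  · have hy : τ y' ∈ (Z₂ : Set E) := hy'
    exact preimage_diff_subset_support_controlledTransform hτ (tr i) (m i) ⟨hZ₂i hy, Set.disjoint_right.mp hd hy⟩
  · have h := HasSNCWith.transform_comap_of_disjoint hτ hsnc hsnc₂ hdC
    rwa [hcomap] at h
  · have h := hτ.controlledTransform_le_pow_comap_of_disjoint hdC (m j) (hm₂ j)
    rwa [hcomap] at h

omit [IsLocallyNoetherian E] in
/-- **THE PIECE STEP (law-parametric).** `E` integral Noetherian regular; hosts `tr i` effective Cartier; boundary traces `𝓑`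
with simple normal crossings; a piece `Z` — `𝓘(Z)` a regular subscheme, inside some host, snc with `𝓑` — and
exponents `m i` with `tr i ≤ 𝓘(Z) ^ m i`; `τ` ANY blowing up along `𝓘(Z)` (irreducibility of the piece is not used here; it
serves the X-side lift).  Then `E'` is integral Noetherian regular, the
transported hosts `τᶜ(tr i, m i)` are effective Cartier with `τ^* tr i = 𝓘(exc)^{m i} · τᶜ(tr i, m i)`, the new boundary
`𝓑.map st ++ [exc]` has simple normal crossings, and the two support bounds, the boundary bound and the boundary cover hold.
[cite: Kollar2007, 3.30.2, Def. 3.25] [cite: BierstoneGrigorievMilmanWlodarczyk2011, §3.2, Def. 3.1.3] [cite: CossartJannsenSaito2020, (6.2)] -/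
theorem piece_step [IsIntegral E] [IsNoetherian E] (hE : Scheme.IsRegular E) (htr : ∀ i, IsEffectiveCartier (tr i))
    (hZ : Scheme.IsRegular (vanishingIdeal Z).subscheme)
    {i₀ : Fin n} (hZi₀ : (Z : Set E) ⊆ (tr i₀).support) (hsnc : HasSNCWith 𝓑 (vanishingIdeal Z))
    (m : Fin n → ℕ) (hm : ∀ i, tr i ≤ vanishingIdeal Z ^ m i)
    {B₀ : Set E} (h𝓑B : ∀ T ∈ 𝓑, (T.support : Set E) ⊆ B₀) (hZB : (Z : Set E) ⊆ B₀) (hτ : IsBlowup τ (vanishingIdeal Z)) :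
    ∃ (_ : IsIntegral E') (_ : IsNoetherian E'),
      Scheme.IsRegular E' ∧
      (∀ i, IsEffectiveCartier (controlledTransform τ (vanishingIdeal Z) (tr i) (m i))) ∧
      (∀ i, (tr i).comap τ = (vanishingIdeal Z).comap τ ^ m i * controlledTransform τ (vanishingIdeal Z) (tr i) (m i)) ∧
      HasSNC (𝓑.map (strictTransformIdeal τ (vanishingIdeal Z)) ++ [(vanishingIdeal Z).comap τ]) ∧
      (∀ i, τ ⁻¹' (((tr i).support : Set E) \ (Z : Set E)) ⊆
        ((controlledTransform τ (vanishingIdeal Z) (tr i) (m i)).support : Set E')) ∧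
      (∀ i, ((controlledTransform τ (vanishingIdeal Z) (tr i) (m i)).support : Set E') ⊆ τ ⁻¹' ((tr i).support : Set E)) ∧
      (∀ T' ∈ 𝓑.map (strictTransformIdeal τ (vanishingIdeal Z)) ++ [(vanishingIdeal Z).comap τ],
        (T'.support : Set E') ⊆ τ ⁻¹' B₀) ∧
      (∀ x' : E', ((∃ T ∈ 𝓑, τ x' ∈ T.support) ∨ τ x' ∈ (Z : Set E)) →
        ∃ T' ∈ 𝓑.map (strictTransformIdeal τ (vanishingIdeal Z)) ++ [(vanishingIdeal Z).comap τ], x' ∈ T'.support) := by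
  -- the centre is not the zero ideal: `Z ⊆ Supp (tr i₀)`, a proper closed subset
  have hCne : vanishingIdeal Z ≠ ⊥ := by
    intro h0
    have hZu : (Z : Set E) = Set.univ := by
      rw [← Scheme.IdealSheafData.coe_support_vanishingIdeal Z, h0, Scheme.IdealSheafData.support_bot]; rfl
    have hdense := (htr i₀).dense_compl_support
    have hempty : (((tr i₀).support : Set E)ᶜ) = ∅ := by
      rw [Set.compl_empty_iff, Set.eq_univ_iff_forall]
      intro x
      exact hZi₀ (by rw [hZu]; trivial)
    have := hdense.nonempty
    rw [hempty] at this
    exact Set.not_nonempty_empty this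
  haveI hint' : IsIntegral E' := hτ.isIntegral hCne
  haveI hnoeth' : IsNoetherian E' := isNoetherian_of_isBlowup hτ
  exact ⟨hint', hnoeth', hτ.isRegular_of_isRegular_subscheme hE hZ,
    fun i => hτ.isEffectiveCartier_controlledTransform_of_le_pow (htr i) (hm i),
    fun i => hτ.comap_eq_pow_mul_controlledTransform_of_le_pow (hm i), hsnc.hasSNC_transform hτ,
    fun i => preimage_diff_subset_support_controlledTransform hτ (tr i) (m i),
    fun i => support_controlledTransform_subset _ _ _, bd_bound h𝓑B hZB, fun x' hx => bd_cover hτ hx⟩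

end Step

/-! ## §3 The pieces of a CJS centre, read on the carrier -/

/-- **The pieces of a CJS centre.** Let `e : E ≅ Z'` identify the carrier with the CJS stage, `X' ⊆ Z'` the (closed) strict
transform with `e⁻¹ X' ⊆ ⋃ Supp trᵢ`, the boundary traces `𝓑` (snc) drawn on `e⁻¹ B'`.  A CJS centre — an ideal `C ≠ ⊤` on `Z'`
with `V(C)` regular, `𝓘(cl X') ≤ C`, `V(C)` n.c. with `B'` — pulls back to `C₀ := e^* C` with `V(C₀)` regular, whose pieces
(`Kollar2007.boundaryPieces`, a partition of `V(C₀)`) are non-empty in number and each irreducible, with `𝓘(piece)` a regular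
subscheme, inside SOME host trace, and having simple normal crossings with `𝓑` (CJS n.c. ⇒ snc: res-type-019's
`hasSNCWith_of_isNormalCrossingWith`, pushed through `e`). [cite: CossartJannsenSaito2020, (6.2), Def. 4.1]
[cite: Kollar2007, Def. 3.25] [cite: BierstoneGrigorievMilmanWlodarczyk2011, Def. 3.1.3 (2)] -/
theorem centre_pieces {E Z' : Scheme.{u}} [IsLocallyNoetherian E] [NoetherianSpace E] [IsLocallyNoetherian Z'] (e : E ≅ Z')
    {n : ℕ} {tr : Fin n → E.IdealSheafData} {𝓑 : List E.IdealSheafData} (h𝓑 : HasSNC 𝓑) {X' B' : Set Z'}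
    (hX'c : IsClosed X') (hlow : e.hom ⁻¹' X' ⊆ ⋃ i, ((tr i).support : Set E))
    (hbd : ∀ T ∈ 𝓑, (T.support : Set E) ⊆ e.hom ⁻¹' B') {C : Z'.IdealSheafData} (hC0 : C ≠ ⊤)
    (hreg : Scheme.IsRegular C.subscheme) (hsub : vanishingIdeal ⟨closure X', isClosed_closure⟩ ≤ C)
    (hnc : IsNormalCrossingWith Z' (C.support : Set Z') B') :
    Scheme.IsRegular (C.comap e.hom).subscheme ∧ Kollar2007.boundaryPieces (C.comap e.hom) ≠ [] ∧
      IsPiecePartition (C.comap e.hom) (Kollar2007.boundaryPieces (C.comap e.hom)) ∧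
      (((C.comap e.hom).support : Set E) = e.hom ⁻¹' (C.support : Set Z')) ∧
      ∀ Z ∈ Kollar2007.boundaryPieces (C.comap e.hom),
        IsIrreducible (Z : Set E) ∧ Scheme.IsRegular (vanishingIdeal Z).subscheme ∧
          (∃ i, (Z : Set E) ⊆ (tr i).support) ∧ HasSNCWith 𝓑 (vanishingIdeal Z) := by
  have hCne : (C.support : Set Z').Nonempty := by
    rw [Set.nonempty_iff_ne_empty]
    intro h0
    apply hC0
    rw [← Scheme.IdealSheafData.support_eq_bot_iff]
    exact Closeds.ext h0
  have hC₀reg : Scheme.IsRegular (C.comap e.hom).subscheme := isRegular_subscheme_comap_of_isOpenImmersion e.hom C hreg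
  have hC₀s : ((C.comap e.hom).support : Set E) = e.hom ⁻¹' C.support := by
    rw [support_comap]; rfl
  have hCX : (C.support : Set Z') ⊆ X' := by
    intro y hy
    have h : y ∈ ((vanishingIdeal (⟨closure X', isClosed_closure⟩ : Closeds Z')).support : Set Z') :=
      support_antitone hsub hy
    rw [Scheme.IdealSheafData.coe_support_vanishingIdeal] at h
    change y ∈ closure X' at h
    rwa [hX'c.closure_eq] at h
  have hP : IsPiecePartition (C.comap e.hom) (Kollar2007.boundaryPieces (C.comap e.hom)) :=
    isPiecePartition_boundaryPieces_of_isRegular hC₀reg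
  have hne : Kollar2007.boundaryPieces (C.comap e.hom) ≠ [] := by
    intro h0
    rw [boundaryPieces_eq_nil_iff] at h0
    obtain ⟨y, hy⟩ := hCne
    have h : e.inv y ∈ ((C.comap e.hom).support : Set E) := by
      rw [hC₀s, Set.mem_preimage, hom_inv_apply]; exact hy
    rw [h0, Scheme.IdealSheafData.support_top] at h
    exact h
  -- the boundary traces have snc with the centre (CJS's normal crossings on `Z'`, pushed through `e`)
  have hsncC : HasSNCWith 𝓑 (C.comap e.hom) :=
    hasSNCWith_comap_of_isNormalCrossingWith e h𝓑 hbd (eq_vanishingIdeal_support_of_isRegular C hreg) hnc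
  refine ⟨hC₀reg, hne, hP, hC₀s, fun Z hZ => ⟨isIrreducible_of_mem_boundaryPieces hZ,
    isRegular_subscheme_vanishingIdeal_piece hC₀reg hP hZ, ?_, hsncC.centrePiece hP hZ⟩⟩
  refine exists_subset_support_of_subset_iUnion tr (isIrreducible_of_mem_boundaryPieces hZ) fun x hx => hlow ?_
  have h1 : x ∈ ((C.comap e.hom).support : Set E) := hP.subset hZ hx
  rw [hC₀s] at h1
  exact hCX h1

end MultiHostCJS

end Summit.ResolutionOfSingularities.ResolutionOfSingularities.Theorems

end
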